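import Summits.HodgeConjecture.HodgeConjecture.Theses.SevenfoldWeilCensus
import Summits.HodgeConjecture.HodgeConjecture.Theses.RankFourFaces
import Summits.HodgeConjecture.HodgeConjecture.Theses.ConservativityLefschetz
import Summits.HodgeConjecture.HodgeConjecture.Theses.PadicSemiregularLift
import Summits.HodgeConjecture.HodgeConjecture.Theorems.SevenfoldWeilCensusAbelianComplementBridgeSplit
import HarnessLib

/-!
# Line `milestone_bridge` for crux `AbelianComplement` (stmt-HodgeConjecture-15889), route SevenfoldWeilCensus

Skeleton of the BRIDGE decomposition (strategist q1): the crux — the Hodge conjecture off the abelian locus,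
kernel-checked equivalent to the summit — is assembled from exactly two registered stubs, each the text of an
EXISTING item of the portfolio:

* `stub_hodgeAbelianVarieties` = item stmt-HodgeConjecture-1333 (`PadicSemiregularLift.HodgeAbelianVarieties`):
  the Hodge conjecture for every complex abelian variety — the abelian MILESTONE (inside this route it is the
  output of `Assembly` (dim ≤ 7) and of the residual `HodgeAbelianDimGeEight`, which alone already implies it:
  `Theorems/SevenfoldWeilCensusResidualAbelianAllDimensions.lean`);
* `stub_abelianToHodge` = item stmt-HodgeConjecture-10452 (`ConservativityLefschetz.AbelianComplement`):
  the Hodge conjecture granted the abelian case — the BRIDGE off the abelian locus (residual; its own line one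
  level down is `Lines/abelian_domination.lean`).

The composition `AbelianComplement_of` is the landed
`Theorems.AbelianComplement.BridgeSplit.abelianComplement_of_items` (p172642). Sorries only inside `stub_*`.
-/

-- Summit.HodgeConjecture.HodgeConjecture.… repeats the summit name by the D-0017 layout (Sub = Summit).
set_option linter.dupNamespace false

namespace Summit.HodgeConjecture.HodgeConjecture.Cruxes.AbelianComplement.MilestoneBridge

open Summit.HodgeConjecture.HodgeConjecture.Theses

/-- stub 1 — the abelian milestone (item stmt-HodgeConjecture-1333, verbatim by name). -/
theorem stub_hodgeAbelianVarieties : PadicSemiregularLift.HodgeAbelianVarieties := by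
  sorry

/-- stub 2 — the bridge off the abelian locus (item stmt-HodgeConjecture-10452, verbatim by name). -/
theorem stub_abelianToHodge : ConservativityLefschetz.AbelianComplement := by
  sorry

/-- The composition, concluding the crux BY NAME (landed assembly, p172642). -/
theorem AbelianComplement_of :
    PadicSemiregularLift.HodgeAbelianVarieties → ConservativityLefschetz.AbelianComplement →
      Summit.HodgeConjecture.HodgeConjecture.Theses.SevenfoldWeilCensus.AbelianComplement :=
  Theorems.AbelianComplement.BridgeSplit.abelianComplement_of_items

/-- The composition on the item's primary (RankFourFaces) decl — the two route decls are one proposition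
(`Theorems.AbelianComplement.BridgeSplit.sevenfold_iff_rankFourFaces`, `Iff.rfl`). -/
theorem AbelianComplementRFF_of :
    PadicSemiregularLift.HodgeAbelianVarieties → ConservativityLefschetz.AbelianComplement →
      Summit.HodgeConjecture.HodgeConjecture.Theses.RankFourFaces.AbelianComplement :=
  Theorems.AbelianComplement.BridgeSplit.abelianComplementRFF_of_items

/-- The crux (primary decl of item stmt-HodgeConjecture-15889) from the stubs. -/
theorem AbelianComplement_proof :
    Summit.HodgeConjecture.HodgeConjecture.Theses.RankFourFaces.AbelianComplement :=
  AbelianComplementRFF_of stub_hodgeAbelianVarieties stub_abelianToHodge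

/-- The crux (SevenfoldWeilCensus decl) from the stubs. -/
theorem abelianComplement :
    Summit.HodgeConjecture.HodgeConjecture.Theses.SevenfoldWeilCensus.AbelianComplement :=
  AbelianComplement_of stub_hodgeAbelianVarieties stub_abelianToHodge

end Summit.HodgeConjecture.HodgeConjecture.Cruxes.AbelianComplement.MilestoneBridge
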